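import Summits.QuantumFields.BalabanUV.T4Continuum.Spine.NE1p.DressedRootSameLattice

/-!
# T⁴ programme, spine estimate NE1′ (node O3b/H2) — NON-VACUITY OF THE SAME-LATTICE FACE (decided toy): the function-level
# binders of `DressedRootSameLattice.dressedStabilityStrict_of_sameLattice` jointly inhabited at EVERY cutoff with ONE number set,
# by a NON-CONSTANT carried function with positive responses

Cell `pub-balaban`, sub-cell `t4`, BINDER-OWNERS row NE1′; owner lineage t4-ne1p-p1 (PROVER seat P1), generation 25; ADDITIVE —
imports `Spine/NE1p/DressedRootSameLattice` (p218843) ONLY, modifies nothing.  Sibling of `Spine/NE1p/DressedRootWitness.lean`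
(p211675: non-vacuity of END-B).

CONTENTS [decided toy, nothing of Bałaban's is modelled].  Block size `L = 2` (rate `ψ = L⁻² = 1/4`, source decay `τ = L⁻³ = 1/8`,
count rate `Λ = L⁴ = 16`); per cutoff `K` ONE observable-attached family born at scale `0`, felt at one cube of every scale, with
POSITIVE booked size `slSize K k = (1/12)·(1/4)^k·(1/8)^K` (`slSize_pos`); one generation (the birth, size `(1/8)^K`).  FUNCTION
LEVEL on `𝒰 = Dir = F = ℂ` with the affine chart `move U d t = U + t·d`, window norm `‖d‖`, window `w = 1`, radius `r = 1`,
regular set `{0}`: the carried function of the birth generation is the NON-CONSTANT linear functional `U ↦ ((1/8)^K/3)·U` (later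
generations carry `0`), gauge relation `=`; its birth slice holds with sup `(1/8)^K` on the discs of radius `1/‖d‖` about `[0,1]`
(`slFn_birthSlice`); the attaining pair at scale `k` is `(0, δ_k)` with the NORMALISED defect `δ_k = c_δ·r·ψ^k = (1/4)·(1/4)^k`
(`slPair`), whose response `((1/8)^K/3)·δ_k` IS the booked size.  Number set: `c_δ = 1/4` (transport constant `4c_δ = 1`), no
regeneration (`c̄ = 0`), `N₀ = A₀ = 1`, `m = 1/2`, `s̄⁰ = 0`, `ρ′ = locOf 2 1 1 0 = 1/2`.  **`dressedStabilityStrict_slTower :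
DressedStabilityStrict slTower (2^4)`** is obtained THROUGH `dressedStabilityStrict_of_sameLattice` — every one of its binders
(`hinv`, `hsl` at birth, `hr`, `hdefw`, `hrate`, `hlin`, `hbirth`, `hreg`, counts, margins, arithmetic) discharged on the toy.

HONEST FRAMING.  A decided toy exercising the END's binder family end to end (non-vacuity of the same-lattice face, node-test item
(t5)); it says NOTHING about Bałaban's densities or the cell's D-terms.  NE1′ NOT printed, NOT proved; spine PROVED 0∕9.  Rung (B)+1 on
ONE finite four-torus — NOT infinite volume, NOT a mass gap, NOT OS on ℝ⁴, NOT Clay.  HONEST DEPENDENCY: continuum YM on T⁴ ⇐ BetaPertH ∧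
nine spine estimates (0/9 proved); BetaPertH ⇐ (D1) ∧ (D4) ∧ CAP+tail; G-an2-4 gates asym, D1 and NE2/3/4.
-/

noncomputable section

namespace Summit.QuantumFields.BalabanUV.T4Continuum.NE1p.DressedRootSameLatticeWitness

open Finset Metric Set
open scoped BigOperators
open Literature.MathematicalPhysics.QuantumFieldTheory.Balaban1983to89
open Literature.MathematicalPhysics.QuantumFieldTheory.Balaban1983to89.T4TermFormat
open Literature.MathematicalPhysics.QuantumFieldTheory.Balaban1983to89.T4TrajectoryComparison
open Literature.MathematicalPhysics.QuantumFieldTheory.Balaban1983to89.T4BirthChartTransport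
  (GaugeInvariant BirthSlice RelGauge)
open Summit.QuantumFields.BalabanUV.T4Continuum.T4TrajectoryDensityDressed
open Summit.QuantumFields.BalabanUV.T4Continuum.NE1p.DressedRoot
open Summit.QuantumFields.BalabanUV.T4Continuum.NE1p.DressedUniformConstants
open Summit.QuantumFields.BalabanUV.T4Continuum.NE1p.DressedRootSameLattice

/-! ## §1 The toy booking, trajectory and tower -/

/-- The toy's booked size at scale `k` of cutoff `K`: `(1/12)·(1/4)^k·(1/8)^K`. [decided toy] -/
def slSize (K k : ℕ) : ℝ := (1 / 12 : ℝ) * (1 / 4 : ℝ) ^ k * (1 / 8 : ℝ) ^ K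

/-- The toy's sizes are positive. [decided toy] -/
theorem slSize_pos (K k : ℕ) : 0 < slSize K k := by
  unfold slSize; positivity

/-- TOY BOOKING at cutoff `K` [decided toy]: one family born at scale `0`, one cube per scale, size `slSize K k`. -/
def slBooking (K : ℕ) : T4TermFormat.Booking where
  K := K
  Dom := Unit
  domScale := fun _ => 0
  treeLen := fun _ => 0
  treeLen_nonneg := fun _ => le_rfl
  balSize := fun _ => 0
  Birth := Unit
  births := {()}
  mem_births := fun b => by simp
  birthScale := fun _ => 0
  birth_le := fun _ => Nat.zero_le K
  loc := fun _ => ()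
  loc_scale := fun _ => rfl
  Cube := Fin (K + 1)
  cubes := Finset.univ
  mem_cubes := fun q => Finset.mem_univ q
  cubeScale := fun q => q.val
  cube_le := fun q => Nat.lt_succ_iff.mp q.isLt
  feltAt := fun _ => {()}
  felt_birth_le := fun _ _ _ => Nat.zero_le _
  size := fun _ k => slSize K k
  size_nonneg := fun _ k => (slSize_pos K k).le
  pair := fun _ _ _ => 0

/-- TOY TRAJECTORY [decided toy]: one generation (the birth, size `(1/8)^K`); re-linearised size = the booked size. -/
def slTrajectory (K : ℕ) : Trajectory (slBooking K) where
  lin := fun _ k' k => if k' = 0 then slSize K k else 0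
  lin_nonneg := fun _ k' k => by
    split_ifs
    · exact (slSize_pos K k).le
    · exact le_rfl
  gen := fun _ k' => if k' = 0 then (1 / 8 : ℝ) ^ K else 0
  gen_nonneg := fun _ k' => by split_ifs <;> positivity
  size_le := fun b k _ _ => by
    show slSize K k ≤ ∑ k' ∈ Icc 0 k, (if k' = 0 then slSize K k else 0)
    rw [Finset.sum_ite_eq' (Icc 0 k) 0 (fun _ => slSize K k)]
    simp

/-- TOY TOWER [decided toy]: one run parameter, the toy booking and trajectory at every cutoff. -/
def slTower : DressedTower Unit where
  B := fun _ K => slBooking K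
  K_eq := fun _ _ => rfl
  T := fun _ K => slTrajectory K

/-! ## §2 The function-level data: a non-constant carried function, its birth slice, the attaining pairs -/

/-- The affine chart on `ℂ`: `move U d t = U + t·d`. [decided toy] -/
def slMove (U d : ℂ) (t : ℂ) : ℂ := U + t * d

/-- The carried function of generation `k′` at cutoff `K`: the linear functional `U ↦ ((1/8)^K/3)·U` for the birth generation,
`0` for later (empty) generations. [decided toy] -/
def slFn (K : ℕ) (k' : ℕ) (U : ℂ) : ℂ := if k' = 0 then (((1 / 8 : ℝ) ^ K / 3 : ℝ) : ℂ) * U else 0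

/-- The chart fixes the base at `t = 0`. [decided toy] -/
theorem slMove_zero (U d : ℂ) : slMove U d 0 = U := by
  simp [slMove]

/-- Gauge invariance under equality is trivial. [decided toy] -/
theorem slFn_gaugeInvariant (K k' : ℕ) : GaugeInvariant (fun U V : ℂ => U = V) (slFn K k') :=
  fun _ _ h => by rw [h]

/-- **THE BIRTH SLICE OF THE TOY** [decided toy]: at the regular base `0`, along every direction `d` with `0 < ‖d‖ ≤ 1`, the
slice `t ↦ slFn K k′ (0 + t·d)` is entire and bounded by the generation size on the open disc `|t| < 3/‖d‖`, which contains the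
closed discs of radius `1/‖d‖` about `[0,1]`. -/
theorem slFn_birthSlice (K k' : ℕ) :
    BirthSlice (slFn K k') slMove (fun d : ℂ => ‖d‖) ({0} : Set ℂ) 1 1 (if k' = 0 then (1 / 8 : ℝ) ^ K else 0) := by
  intro U hU d hd hdw
  rw [Set.mem_singleton_iff] at hU
  subst hU
  refine ⟨ball (0 : ℂ) (3 / ‖d‖), ?_, ?_, ?_⟩
  · unfold slFn slMove
    split_ifs
    · exact ((differentiableOn_const _).mul ((differentiableOn_const _).add
        (differentiableOn_id.mul (differentiableOn_const _))))
    · exact differentiableOn_const _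
  · intro t ht
    rw [mem_ball, dist_zero_right] at ht
    unfold slFn slMove
    split_ifs with h
    · have h8 : (0 : ℝ) ≤ (1 / 8 : ℝ) ^ K := by positivity
      have ht' : ‖t‖ * ‖d‖ < 3 := by
        have := (lt_div_iff₀ hd).1 ht
        linarith
      rw [zero_add, norm_mul, norm_mul, Complex.norm_real, Real.norm_eq_abs,
        abs_of_nonneg (by positivity : (0 : ℝ) ≤ (1 / 8 : ℝ) ^ K / 3)]
      calc (1 / 8 : ℝ) ^ K / 3 * (‖t‖ * ‖d‖) ≤ (1 / 8 : ℝ) ^ K / 3 * 3 :=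
            mul_le_mul_of_nonneg_left ht'.le (by positivity)
        _ = (1 / 8 : ℝ) ^ K := by ring
    · simp
  · intro s hs z hz
    rw [mem_closedBall] at hz
    rw [mem_ball, dist_zero_right]
    have hs1 : ‖(s : ℂ)‖ ≤ 1 := by
      rw [Complex.norm_real, Real.norm_eq_abs, abs_of_nonneg hs.1]; exact hs.2
    have hd1 : (1 : ℝ) ≤ 1 / ‖d‖ := by rw [le_div_iff₀ hd]; linarith
    calc ‖z‖ = ‖(z - s) + s‖ := by rw [sub_add_cancel]
      _ ≤ ‖z - (s : ℂ)‖ + ‖(s : ℂ)‖ := norm_add_le _ _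
      _ ≤ 1 / ‖d‖ + 1 := add_le_add (by rwa [← dist_eq_norm]) hs1
      _ ≤ 1 / ‖d‖ + 1 / ‖d‖ := add_le_add le_rfl hd1
      _ < 3 / ‖d‖ := by
          have hx : 0 < 1 / ‖d‖ := by positivity
          have h3 : 3 / ‖d‖ = 3 * (1 / ‖d‖) := by ring
          rw [h3]; linarith

/-- The NORMALISED defect of the toy: `c_δ·r·ψ^{k−k′}` with `c_δ = 1/4`, `r = 1`, `ψ = (2²)⁻¹`. [decided toy] -/
def slDefect (k' k : ℕ) : ℝ := (1 / 4 : ℝ) * 1 * ((2 : ℝ) ^ 2)⁻¹ ^ (k - k')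

/-- The defect is positive. [decided toy] -/
theorem slDefect_pos (k' k : ℕ) : 0 < slDefect k' k := by
  unfold slDefect; positivity

/-- The pair `(0, δ)` with `δ = slDefect k′ k > 0` is in relative gauge of defect `δ` on the affine chart (direction `δ` itself).
[decided toy] -/
theorem slRel (k' k : ℕ) :
    RelGauge (fun U V : ℂ => U = V) slMove (fun d : ℂ => ‖d‖) 0 ((slDefect k' k : ℝ) : ℂ) (slDefect k' k) := by
  have hn : ‖((slDefect k' k : ℝ) : ℂ)‖ = slDefect k' k := by
    rw [Complex.norm_real, Real.norm_eq_abs, abs_of_pos (slDefect_pos k' k)]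
  refine ⟨((slDefect k' k : ℝ) : ℂ), ?_, ?_, ?_⟩
  · show (0 : ℝ) < ‖((slDefect k' k : ℝ) : ℂ)‖
    rw [hn]; exact slDefect_pos k' k
  · show ‖((slDefect k' k : ℝ) : ℂ)‖ ≤ slDefect k' k
    rw [hn]
  · simp [slMove]

/-- **THE ATTAINING PAIR** [decided toy]: the response of the birth generation's function to the pair `(0, δ_k)`,
`δ_k = slDefect 0 k`, IS the booked size: `((1/8)^K/3)·(1/4)·(1/4)^k = slSize K k`. -/
theorem slPair (K k : ℕ) : slSize K k = ‖slFn K 0 ((slDefect 0 k : ℝ) : ℂ) - slFn K 0 0‖ := by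
  simp only [slFn, if_true, mul_zero, sub_zero, norm_mul, Complex.norm_real, Real.norm_eq_abs]
  rw [abs_of_nonneg (by positivity : (0 : ℝ) ≤ (1 / 8 : ℝ) ^ K / 3), abs_of_pos (slDefect_pos 0 k)]
  unfold slSize slDefect
  rw [Nat.sub_zero]
  have h4 : ((2 : ℝ) ^ 2)⁻¹ = 1 / 4 := by norm_num
  rw [h4]
  ring

/-! ## §3 ROOT-C of record THROUGH the same-lattice face -/

/-- **NON-VACUITY OF THE SAME-LATTICE FACE** [decided toy]: the toy tower has `DressedStabilityStrict slTower (2^4)` THROUGH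
`dressedStabilityStrict_of_sameLattice` — one number set (`L = 2`, `c_δ = 1/4`, `c̄ = 0`, `N₀ = A₀ = 1`, `m = 1/2`, `s̄⁰ = 0`,
`ρ′ = 1/2`), and at every cutoff the function-level binders (non-constant carried function, birth slice at birth only, normalised
attaining pairs), the births leaf, the (empty) regeneration leaf and the counts, all discharged. -/
theorem dressedStabilityStrict_slTower : DressedStabilityStrict slTower ((2 : ℝ) ^ 4) := by
  refine dressedStabilityStrict_of_sameLattice slTower (L := 2) (cδ := 1 / 4) (cbar := 0) (N₀ := 1) (A₀ := 1) (m := 1 / 2)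
    (sbar := 0) (ρ' := 1 / 2) (𝒰 := ℂ) (Dir := ℂ) (F := ℂ) (move := slMove)
    (by norm_num) (by norm_num) le_rfl zero_le_one zero_le_one (by norm_num)
    (by unfold locOf; norm_num) (by norm_num) (by norm_num)
    (fun _ _ _ => 0) (fun _ _ _ _ => 0) (fun _ _ _ b => {b})
    (fun _ _ _ => le_rfl) (fun _ _ _ _ => le_rfl)
    (fun _ K k b f _ => Nat.zero_le k)
    (fun _ K k b j _ => ?_)
    (fun _ _ _ _ => le_rfl)
    (fun _ K => ?_) (fun _ K => ?_)
    (fun _ K _ k' => slFn K k') (fun _ _ _ _ U V => U = V) (fun _ _ _ _ => ({0} : Set ℂ)) (fun _ _ _ _ d => ‖d‖)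
    (fun _ _ _ _ => 1) (fun _ _ _ _ => 1) (fun _ _ _ k' k => slDefect k' k)
    (fun _ K _ k' => slFn_gaugeInvariant K k')
    (fun _ K b k' _ _ _ => slFn_birthSlice K k')
    slMove_zero (fun _ _ _ _ => zero_lt_one)
    (fun _ _ _ k' k => ?_)
    (fun _ _ _ k' k _ _ _ => ?_)
    (fun _ K b k' k hbk' hk'k hk _ ε hε => ?_)
  · -- counts: one live family, `N₀·(2⁴)^{k−j} ≥ 1`
    show ((({b} : Finset Unit).filter fun _ => (0 : ℕ) = j).card : ℝ) ≤ 1 * ((2 : ℝ) ^ 4) ^ (k - j)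
    have h1 : ((({b} : Finset Unit).filter fun _ => (0 : ℕ) = j).card : ℝ) ≤ 1 := by
      exact_mod_cast (Finset.card_filter_le _ _).trans (Finset.card_singleton b).le
    exact h1.trans (by simpa using one_le_pow₀ (M₀ := ℝ) (a := (2 : ℝ) ^ 4) (n := k - j) (by norm_num))
  · -- births: `1·(1/8)^K ≤ twoRate 1 ρ₁ (2⁻¹)³ K 0 0 = (2⁻¹)^3^K`
    intro b _ _ _
    show 4 * (1 / 4 : ℝ) * (if (0 : ℕ) = 0 then (1 / 8 : ℝ) ^ K else 0) ≤
      twoRate 1 (rhoOneOf ((2 : ℝ) ^ 2)⁻¹ 1 (4 * (1 / 4)) 0) ((2 : ℝ)⁻¹ ^ 3) K 0 0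
    simp only [if_true, twoRate, Nat.sub_zero, pow_zero, mul_one, one_mul]
    have h8 : ((2 : ℝ)⁻¹ ^ 3) = 1 / 8 := by norm_num
    rw [h8]
    norm_num
  · -- regeneration: later generations are empty
    intro b k _ _ _
    show (if k + 1 = 0 then (1 / 8 : ℝ) ^ K else 0) ≤ 0 * slSize K k
    simp
  · -- window: `c_δ·r·ψ^{k−k′} ≤ 1`
    show slDefect k' k ≤ 1
    unfold slDefect
    have hψ : ((2 : ℝ) ^ 2)⁻¹ ^ (k - k') ≤ 1 := pow_le_one₀ (by norm_num) (by norm_num)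
    nlinarith [hψ, pow_nonneg (by norm_num : (0 : ℝ) ≤ ((2 : ℝ) ^ 2)⁻¹) (k - k')]
  · -- rate: the defect IS `c_δ·r·ψ^{k−k′}`
    show slDefect k' k ≤ 1 / 4 * 1 * ((2 : ℝ) ^ 2)⁻¹ ^ (k - k')
    exact le_rfl
  · -- attainment: the pair `(0, δ)` — for the birth generation its response IS the booked size; later generations book `0`
    refine ⟨0, Set.mem_singleton 0, ((slDefect k' k : ℝ) : ℂ), slRel k' k, ?_⟩
    show (if k' = 0 then slSize K k else 0) ≤ ‖slFn K k' ((slDefect k' k : ℝ) : ℂ) - slFn K k' 0‖ + ε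
    by_cases hk0 : k' = 0
    · subst hk0
      rw [if_pos rfl, ← slPair K k]
      linarith
    · rw [if_neg hk0]
      positivity

/-- … hence the headline `DressedStability slTower` and every booked size positive: the same-lattice END is exercised end to end
on a non-degenerate toy. [decided toy] -/
theorem dressedStability_slTower : DressedStability slTower ∧ ∀ K k (b : (slBooking K).Birth), 0 < (slBooking K).size b k :=
  ⟨dressedStability_of_sameLattice_strict slTower dressedStabilityStrict_slTower, fun K k _ => slSize_pos K k⟩

end Summit.QuantumFields.BalabanUV.T4Continuum.NE1p.DressedRootSameLatticeWitness

end
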